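import Literature.NumberTheory.Transcendental.Zilber
import Literature.NumberTheory.Transcendental.OneMotiveToric
import Literature.NumberTheory.Transcendental.RoyCriterion
import HarnessLib
import HarnessLib.Audit
import HarnessLib.Audit.TribunalTags

/-!
# Strong-Hypothesis Library — summit `Schanuel` (D-0034, skeleton)

The REGISTRY of known strong hypotheses `H` (open conjectures with `H ⇒ P` landed or printed) and of
known EQUIVALENT REFORMULATIONS `E` (`E ↔ P` landed or printed) for the single-problem summit `Schanuel`.
Every entry carries `@[strong_hypothesis "Schanuel.Schanuel"]`; the kernel tribunal (`#h21_tribunal`,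
D-0033 T1 rule (a)) probes each registered `H` against a route crux `C` for `H → C`. The bridges
`H → P` / `H ↔ P` live summit-side in `Summits/Schanuel/StrongHypotheses.lean`. Nothing already in the
tree is restated: existing conjecture `def`s are tagged in place with `attribute [strong_hypothesis …]`;
the ONE new hypothesis stated below is the closure over the rank `l` of Roy's parametrised criterion
`RoyCriterion l` (an OPEN statement, `@[conjecture]`, docstring `OPEN CONJECTURE — … [status: open]`).

## The summit's problem

* `Schanuel.Schanuel` — decl `_root_.Schanuel : Prop := Literature.Periods.SchanuelConjecture`
  (`Summits/Schanuel/Schanuel/Statement.lean`): Schanuel's conjecture (Lang 1966 pp. 30–31;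
  Waldschmidt 2000 Conj. 1.14) — if `z₁, …, zₙ ∈ ℂ` are `ℚ`-linearly independent then
  `trdeg_ℚ ℚ(z₁, …, zₙ, e^{z₁}, …, e^{zₙ}) ≥ n`, rendered `∀ n (z : Fin n → ℂ), LinearIndependent ℚ z →
  n ≤ Algebra.trdeg ℚ ℚ(range z ∪ range (cexp ∘ z))`. Definitionally equal (`Iff.rfl`) to
  `Literature.ModelTheory.ExponentialFields.SchanuelProperty ℂ` and to `∀ l, SchanuelRank l`
  (`RoyCriterion.lean`).

## Census of strong hypotheses `H` and equivalent criteria `E`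

| # | name | one-line statement | relation to `Schanuel` | source | status here | bridge |
|---|---|---|---|---|---|---|
| 1 | Zilber's conjecture on `ℂ_exp` | `ℂ_exp` is a Zilber field (≅ the pseudo-exponential field `𝔹` of cardinality `𝔠`): Schanuel property + strong exponential-algebraic closedness (+ standard kernel, CCP) | strictly stronger (`↔ Schanuel ∧ SEAC`, Bays–Kirby 2018 Thm. 1.4, in tree) | Zilber 2005, Conjecture p. 68; Bays–Kirby 2018 Conj. 1.3 / Thm. 1.4 | registered: `Literature.NumberTheory.Transcendental.ZilberConjecture` | landed: `Summit.Schanuel.StrongHypotheses.zilberConjecture_imp_schanuel` (over `ZilberConjecture.schanuelConjecture`) |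
| 2 | André's generalised period conjecture for toric 1-motives | `trdeg_ℚ k(periods([ℤʳ → 𝔾ₘⁿ])) ≥ dim Gal_mot`, all subfields `k ⊆ ℂ`, all toric 1-motives | equivalent | André 2004 §23.4.1; Bertolin 2002 Cor. 1.3 ("on retrouve la conjecture de Schanuel"); Bertolin 2020 Conj. 0.1 | registered: `Literature.NumberTheory.Transcendental.ToricPeriodConjecture` | landed: `….toricPeriodConjecture_iff_schanuel` (over `toricPeriodConjecture_iff_schanuel_holds`) |
| 3 | Roy's arithmetic criterion, all ranks | Roy's Conjecture 2 for every `l`: small values of an auxiliary polynomial sequence at `(∑ mⱼyⱼ, ∏ αⱼ^{mⱼ})` force `trdeg_ℚ ℚ(y, α) ≥ l` | equivalent (rank by rank, Roy 2001 §5) | Roy 2001, Conj. 2, §1 and §5 | NEW: `Literature.StrongHypotheses.Schanuel.RoyCriterionAll` (closure of the parametrised `RoyCriterion l`) | landed: `….royCriterionAll_iff_schanuel` (over the discharged `Roy2001_iff_holds`) |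
| 4 | André's generalised period conjecture for ALL 1-motives `[X → G]` (`G` semi-abelian) / Bertolin's elliptico-toric conjecture | `trdeg_ℚ k(periods(M)) ≥ dim Gal_mot(M)`; explicitly (elliptico-toric): algebraic independence pattern of `ωᵢ, ηᵢ, Pᵢⱼ, ζ(Pᵢⱼ), log αₖ, 2πi, …` | strictly stronger (contains row 2; printed: toric case = Schanuel, Bertolin 2002 Cor. 1.3, André's letter in Bertolin 2020) | André 2004 §23.4; Bertolin 2002 Conj. 1.1 and (CPG)_K; Bertolin 2020 Conj. 0.1 | not typeable (missing notion: semi-abelian varieties / 1-motives with abelian part and their de Rham–Betti comparison; for the elliptico-toric form, Weierstrass `℘, ζ, σ`, periods and quasi-periods and elliptic logarithms of algebraic points — none in Mathlib or the tree; `OneMotiveToric.lean` states the toric case only, on purpose) | none |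
| 5 | Grothendieck's period conjecture (pure motives) and the Kontsevich–Zagier period conjecture | `trdeg ℚ(periods(X)) = dim G_mot(X)`; equal periods have a rules-proof | INCOMPARABLE as printed: neither covers `e^{α}` (not an effective period; exponential periods need exponential motives) — the passage to Schanuel is only through André's MIXED/1-motivic generalisation (row 4) or Fresán–Jossen's exponential period conjecture (row 6) | Grothendieck 1966; Kontsevich–Zagier 2001 §1.2, §4.1; André 2004 §23; Ayoub 2014 | in tree as `Literature.AlgebraicGeometry.Motives.NoriMotivicInterface.GPCForAll N` (parametrised, with proved junk instances `not_forall_gpcForAll` — registering it would poison the tribunal), `….TorsorPeriodConjecture` (per variety), `Literature.NumberTheory.Transcendental.KZPeriodConjecture'` etc.; NOT registered here | none (no printed `⇒ Schanuel`) |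
| 6 | exponential period conjecture (Grothendieck–André for exponential motives) | fullness/period-torsor conjecture for `M^{exp}(ℚ̄)`; contains `e^{α}`, `γ`, `Γ(p/q)` | expected strictly stronger (the exponential motives attached to `(zᵢ, e^{zᵢ})` have `e^{zᵢ}` among their periods; the precise printed relation to Schanuel was NOT verified on the page in this pass — census only, no bridge claimed) | Fresán–Jossen 2020 (book ms.), Introduction and Ch. 12–13 | not typeable (missing notion: exponential motives, rapid-decay cohomology, their motivic Galois group) | none |
| 7 | Zilber's uniform Schanuel conjecture (USC) | for every `ℚ`-defined exponential variety `V ⊆ ℂⁿ × (ℂˣ)ⁿ` with `dim V < n`, the points `(x, e^x) ∈ V` lie in finitely many proper `ℚ`-linear subspaces (uniformly) | strictly stronger (USC ⟹ SC, Zilber 2002 §1) | Zilber 2002 (JLMS 65), §1 | candidate (not yet in tree): typeable in principle over `Literature.NumberTheory.Transcendental.ExpVarieties` (`≫ 15` lines: needs the free-variety / dimension side conditions); not attempted in this skeleton pass | none |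

## Deliberately NOT registered (and why)

* REFUTED in tree (would make every probe vacuous): `Literature.Barriers.Schanuel.StrongSchanuelConjecture`
  ("(SC) holds in every exponential field elementarily equivalent to `ℂ_exp`" — false by the ultrapower,
  `not_strongSchanuelConjecture`, Kirby 2018 §3 / Kirby–Zilber 2014 §2.1).
* WEAKER than the summit (consequences of `Schanuel`, many with the implication proved in tree):
  `Literature.NumberTheory.Transcendental.FourExponentialsConjecture`, `….StrongFourExponentialsConjecture`,
  `Literature.Barriers.Schanuel.WaldschmidtConjecture_2_3` (`Schanuel ⟹ Conj. 2.3 ⟹ four exponentials`,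
  `waldschmidtConjecture_2_3_of_schanuel`), `….GelfondExpLogConjecture` (Waldschmidt 1974 Conj. 7.5.3),
  `….PiExpAlgebraicIndependence`, `Literature.Barriers.Schanuel.AlgIndepLogarithms`,
  `….ThreeLogarithmsConjecture`, `Literature.Barriers.Schanuel.ToricPeriodConjectureQbar` (row 2 with the base
  restricted to `k ⊆ ℚ̄` = algebraic independence of logarithms), `….ExpOnePiAlgebraicIndependent`,
  `ExpOneAddPiIrrational`, `ExpOneMulPiIrrational`, `….GelfondPowerTowerConjectureReal`, the Schanuel
  property of `ℝ_exp` (`schanuelProperty_real_of_complex_holds`) and its model-theoretic consequences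
  (`Literature.ModelTheory.ExponentialFields.RealExpDecidable`, `LastRootConjecture` via Macintyre–Wilkie),
  the E-function non-value statements of `Literature/Barriers/Schanuel/EFunctionValuesAtAlgebraicPoints.lean`.
* INCOMPARABLE: `Literature.NumberTheory.Transcendental.ConjectureOnIntersectionsWithTori` (CIT: with SC it
  gives SEAC-type closure, Kirby–Zilber 2014, but does not imply SC), `….ZilberQuasiminimalityConjecture`
  (implied by Zilber's conjecture and by EAC alone, Bays–Kirby Thm. 1.5; no arrow to SC),
  `Literature.Barriers.Schanuel.ExpTranscendentalOverPeriodField` (Fresán's expectation),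
  `….NesterenkoConjecture_1_11_corrected` (modular values), the MZV conjectures (`ZagierConjecture`, …),
  the standard conjectures and the Hodge conjecture (`Literature/AlgebraicGeometry/Motives/…`).
* EQUIVALENT BUT NOT A DECL: `∀ l, SchanuelRank l` and `SchanuelProperty ℂ` ARE the summit up to `Iff.rfl`
  (regrouping / instance unfolding), not reformulations; `SchanuelRank` is parametrised. Not tagged.
* THEOREMS, not hypotheses: Ax's theorem (Schanuel for power series / differential fields,
  `Literature.NumberTheory.Transcendental.ax_schanuel_holds`), Lindemann–Weierstrass, Baker, Nesterenko 1996.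
* ROUTE CRITERIA and summit-side conjecture defs: every closed `… : Prop` conjecture under
  `Summits/Schanuel/Schanuel/` is a Theses decl (`Theses/Zilber.lean`, `Theses/ToricPeriods.lean`,
  `Theses/RoyCriterion.lean`, …) or an unbuilt `Cruxes/…/Sketch*` (`GiftFeedsHypothesis`); none is tagged.

## Sources (all keys in `lean/references.bib`)

[Lang1966] pp. 30–31; [Waldschmidt2000] Conj. 1.14; [Zilber2005PseudoExp] §1, Conjecture p. 68;
[BaysKirby2018ANT] Conj. 1.3, Thm. 1.4, Thm. 1.5; [Andre2004] §23.4; [Bertolin2002] Conj. 1.1, Cor. 1.3, §3;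
[Bertolin2020] Conj. 0.1 and André's letter; [Roy2001] Conj. 1–2, Thm. 1, §5; [Zilber2002] §1;
[Kirby2018Variants] §3 Conj. 3.3; [KirbyZilber2014] §2.1, Thm. 1.5; [FresanJossen2020]; [HuberWustholz2022]
Prologue; [KontsevichZagier2001] §1.2, §4.1.
-/

noncomputable section

/-! ## Existing conjecture `def`s, tagged in place (no restatement) -/

attribute [strong_hypothesis "Schanuel.Schanuel"]
  Literature.NumberTheory.Transcendental.ZilberConjecture
  Literature.NumberTheory.Transcendental.ToricPeriodConjecture

namespace Literature.StrongHypotheses.Schanuel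

open Literature.NumberTheory.Transcendental

/-! ## Newly stated closure of a parametrised criterion -/

/-- OPEN CONJECTURE — **Roy's arithmetic criterion for the values of the exponential function, in every
rank** (D. Roy, *An arithmetic criterion for the values of the exponential function*, Acta Arith. 97
(2001), Conjecture 2, posed in §1): for every `l`, all `ℚ`-linearly independent `y₁, …, y_l ∈ ℂ`, all
`α₁, …, α_l ∈ ℂˣ` and every admissible parameter choice `(s₀, s₁, t₀, t₁, u)` in Roy's window (1), the
existence for all large `N` of non-zero `P_N ∈ ℤ[X₀, X₁]` of partial degrees `≤ N^{t₀}, N^{t₁}` and height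
`≤ e^N` with `|(D^k P_N)(∑ mⱼyⱼ, ∏ αⱼ^{mⱼ})| ≤ exp(−N^u)` (`k ≤ N^{s₀}`, `max mⱼ ≤ N^{s₁}`,
`D = ∂/∂X₀ + X₁∂/∂X₁`) forces `trdeg_ℚ ℚ(y, α) ≥ l` — the closure over `l` of the tree's parametrised
predicate `RoyCriterion l` (`RoyCriterion.lean`). A purely arithmetic (Diophantine-approximation)
statement with no exponential function in it; EQUIVALENT to Schanuel's conjecture rank by rank ("if
[Conjecture 2] is true for some positive integer `l` … then Schanuel's conjecture is true for this value of
`l`. Conversely …", §1; proof §5, in tree `Roy2001_iff_holds`), hence open. Bridge LANDED (summit file).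
[cite: Roy2001, Conjecture 2 (§1) and §5] [status: open] -/
@[conjecture, strong_hypothesis "Schanuel.Schanuel"]
def RoyCriterionAll : Prop :=
  ∀ l : ℕ, RoyCriterion l

end Literature.StrongHypotheses.Schanuel
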